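import Summits.NavierStokesRegularity.FluidComputer.PalasekTowerSupGrowth
import Summits.NavierStokesRegularity.FluidComputer.PalasekTowerRegisterGlobalFloorsAt
import Summits.NavierStokesRegularity.NavierStokesRegularity.Theses.PalasekTowerBreakdown

/-!
# Route `PalasekTowerBreakdown`: the cruxes against the universal amplification function, BY NAME

Cell `ns-blowup`, seat `ns-blowup-ecbridge-1` (g7; holder-of-record of item
stmt-NavierStokesRegularity-19249 `PalasekTowerBreakdown.HeredityAtOne`; `--supports` it, closes
nothing). Companion of `FluidComputer/PalasekTowerSupGrowth.lean` (this seat: the register-free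
predicate `SupGrowthBound ν A T M` — every unforced finite-energy classical flow on `ℝ³` started below
sup-level `A` stays below `M·A` for time `T` — its Leray instance, its Kato-unit normal form, and the
reduction of `AprioriCeilingAt k` to it). LABEL: E–C typing (KERNEL; conditional compositions and ONE
unconditional implication between the route's items and the predicate). WHAT THIS IS NOT: not
Navier–Stokes evidence — nothing is constructed; no item is proved or refuted; `SupGrowthBound` beyond
Leray's window is an OPEN statement used only as a hypothesis or inside a negation that is itself only
DERIVED from the (open) cruxes.

## What is proved (wide rates, registered constants; `Y_k`, `window k = 4bβ·log N_{k+1}/A_k`)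

* §1 the UPPER STUB of 19249 and the item from the predicate + the three floors:
  `SupGrowthBound 1 ((5/3)Y₁) (window 1) (Y₂/Y₁) → AprioriCeilingAt 1`, hence
  `… → SpeedFloorAt 1 → StrainFloorAt 1 → CoreFloorAt 1 → PalasekTowerBreakdown.HeredityAtOne`; the
  sibling `HeredityFromTwo` and the parent `EpisodeInduction` likewise, level by level
  (`…_of_supGrowthBound_floors`): modulo the floors, the whole of K2G follows from ONE register-free
  amplification bound per level, `G(Θ_k) ≤ N_k^{(b−1)(β−1)}` in Kato units
  `Θ_k = (25/9)·4bβ·log N_{k+1}·N_k^{β−2}`.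
* §2 the CONVERSE PRESSURE the cruxes put on the same function — UNCONDITIONAL implication:
  `PalasekTowerBreakdown.EpisodeBase → PalasekTowerBreakdown.EpisodeInduction →
   ∀ m ≥ 1, ∀ M, ¬ SupGrowthBound 1 ((5/3)Y_m) ((3/2)·window m) M`
  — the registered tower, restarted at any readout `τ_m` (`m ≥ 1`, force silent from `τ₁` on), is an
  unforced finite-energy classical flow started below `(5/3)Y_m` whose sup exceeds every multiple of
  it before `τ_m + (3/2)·window m` (rigid windows are geometric with ratio `≤ 1/3`,
  `TowerRates.wide_window_geo`, so every later readout lies within `(3/2)·window m` of `τ_m`; the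
  floors `Y_k → ∞`). In Kato units: the two cruxes together assert `G((3/2)·Θ_m) = ∞` at EVERY level
  `m ≥ 1` (`…_unit`), while §1 derives the upper stubs from `G(Θ_m) ≤ N_m^{0.13}`. The pair is
  consistent (`G` is a supremum over all flows), and it LOCATES the route's analytic content on one
  axis: per window, no flow of the registered class amplifies by more than `N_m^{0.13} ≈ 2.2–2.4`,
  yet the same flow amplifies without bound within `1.5` windows.

References: J. Leray, Acta Math. 63 (1934) §20–§21 [cite: Leray1934, §21 (3.15) p. 226];
S. Palasek, arXiv:2605.13827 §3.3–§4 [cite: Palasek2026ElementaryModel, §4];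
H. Sohr, *The Navier–Stokes Equations* (2001), Ch. V Thm. 1.5.1 [cite: Sohr2001, Ch. V Thm. 1.5.1].
-/

noncomputable section

open Set MeasureTheory Filter Topology Function Real
open scoped ENNReal NNReal

namespace Summit.NavierStokesRegularity.FluidComputer.PalasekTowerClayBridge

open Literature.Analysis.FluidPDE

/-! ## §0 Rigid readouts are within `(3/2)·window m` of `τ_m` -/

/-- Under rigidity on the wide rates, `τ_{m+n} − τ_m = Σ_{i<n} window (i+m)`. [folklore] -/
theorem Schedule.Rigid.τ_add_sub_τ_eq_sum {S : Schedule TowerRates.wide} (hR : S.Rigid) (m n : ℕ) :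
    S.τ (m + n) - S.τ m = ∑ i ∈ Finset.range n, TowerRates.wide.window (i + m) := by
  induction n with
  | zero => simp
  | succ n ih =>
    rw [Finset.sum_range_succ, ← ih, show m + (n + 1) = m + n + 1 by ring,
      show n + m = m + n by ring, ← hR.gap_eq_window (m + n)]
    ring

/-- **Every later readout lies within `(3/2)·window m` of `τ_m`** (rigid wide schedule; the windows
are geometric with ratio `≤ 1/3`, `TowerRates.wide_window_geo`, `Schedule.window_tail_le`). [folklore] -/
theorem Schedule.Rigid.τ_sub_τ_le_window {S : Schedule TowerRates.wide} (hR : S.Rigid) {m k : ℕ}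
    (hmk : m ≤ k) : S.τ k - S.τ m ≤ 3 / 2 * TowerRates.wide.window m := by
  obtain ⟨n, rfl⟩ := Nat.exists_eq_add_of_le hmk
  rw [hR.τ_add_sub_τ_eq_sum m n]
  obtain ⟨hsum, htail⟩ := Schedule.window_tail_le (R := TowerRates.wide) (r := 1 / 3)
    (by norm_num) (by norm_num) TowerRates.wide_window_geo m
  calc ∑ i ∈ Finset.range n, TowerRates.wide.window (i + m)
      ≤ ∑' i, TowerRates.wide.window (i + m) :=
        hsum.sum_le_tsum (Finset.range n) (fun i _ => (TowerRates.wide.window_pos (i + m)).le)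
    _ ≤ TowerRates.wide.window m / (1 - 1 / 3) := htail
    _ = 3 / 2 * TowerRates.wide.window m := by ring

/-! ## §2 (register side) The two cruxes force unbounded amplification within `(3/2)·window m` -/

/-- **K1G ∧ K2G refute every amplification bound from every readout `τ_m`, `m ≥ 1`.** If the globally
anchored registered tower exists (`EpisodeBaseG`) and is hereditary (`EpisodeInductionG`), then for
every `m ≥ 1` and every factor `M` the predicate `SupGrowthBound 1 ((5/3)·Y_m) ((3/2)·window m) M`
FAILS: the level-`k` stage (`rungG_of_episodesG`, `k > m` with `M·(5/3)Y_m < Y_k`, `Y_k → ∞`)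
translated to `τ_m` is an unforced (`Quiet`, `τ₁ ≤ τ_m`) finite-energy classical solution on
`[0, τ_k − τ_m]`, `τ_k − τ_m ≤ (3/2)·window m`, started below the level-`m` ceiling `(5/3)Y_m` and
reading `≥ Y_k` at its end. [cite: Palasek2026ElementaryModel, §4] -/
theorem not_supGrowthBound_of_episodesG (h₁ : EpisodeBaseG) (h₂ : EpisodeInductionG) {m : ℕ}
    (hm : 1 ≤ m) (M : ℝ) :
    ¬ SupGrowthBound 1 (5 / 3 * TowerRates.wide.Y m) (3 / 2 * TowerRates.wide.window m) M := by
  intro hG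
  -- a level `k > m` whose floor beats `M` times the level-`m` ceiling
  obtain ⟨k, hkm, hkM⟩ : ∃ k, m < k ∧ M * (5 / 3 * TowerRates.wide.Y m) < TowerRates.wide.Y k := by
    have hev := (TowerRates.wide.tendsto_Y_atTop.eventually_gt_atTop
      (M * (5 / 3 * TowerRates.wide.Y m))).and (eventually_gt_atTop m)
    obtain ⟨k, hk1, hk2⟩ := hev.exists
    exact ⟨k, hk2, hk1⟩
  -- the registered stage at level `k`
  have hk1 : 1 ≤ k := hm.trans hkm.le
  obtain ⟨S, -, hR, hQ, ⟨s⟩⟩ : RungG k := by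
    have := rungG_of_episodesG h₁ h₂ (k - 1)
    rwa [Nat.sub_add_cancel hk1] at this
  have hτm : 0 < S.τ m := S.τ_pos m
  have hmk : S.τ m < S.τ k := S.τ_strictMono hkm
  -- its translate by `τ_m`: unforced, classical, finite energy, started below `(5/3)·Y_m`
  have hf : ∀ r, S.τ m ≤ r → S.f r = 0 := fun r hr => hQ r ((S.τ_mono hm).trans hr)
  have hU : IsClassicalNSSolutionOn (Icc 0 (S.τ k - S.τ m)) 1 0 (fun r => s.u (r + S.τ m))
      (fun r => s.p (r + S.τ m)) :=
    isClassicalNSSolutionOn_translate_of_silent s.classical hτm.le hmk hf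
  have hEU : ∃ C : ℝ≥0∞, C < ⊤ ∧ ∀ r ∈ Icc 0 (S.τ k - S.τ m),
      ∫⁻ y, ‖s.u (r + S.τ m) y‖ₑ ^ 2 ≤ C := by
    obtain ⟨C, hC, hb⟩ := s.energy
    exact ⟨C, hC, fun r hr => hb (r + S.τ m) ⟨by linarith [hr.1], by linarith [hr.2]⟩⟩
  have hU0 : ∀ y, ‖(fun r => s.u (r + S.τ m)) 0 y‖ ≤ 5 / 3 * TowerRates.wide.Y m := by
    intro y
    simp only [zero_add]
    rw [← hR.c₂_eq]
    exact s.ceiling m hkm.le (S.τ m) ⟨hτm.le, le_rfl⟩ y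
  have hlen : S.τ k - S.τ m ≤ 3 / 2 * TowerRates.wide.window m := hR.τ_sub_τ_le_window hkm.le
  -- the bound at the end of the slab contradicts the level-`k` floor
  obtain ⟨x₀, -, hfl⟩ := s.floor k le_rfl
  have key := hG (by linarith) hlen _ _ hU hEU hU0 (S.τ k - S.τ m) ⟨by linarith, le_rfl⟩ x₀
  simp only [sub_add_cancel] at key
  rw [hR.c₁_eq, one_mul] at hfl
  linarith

/-- **The same in Kato units**: K1G ∧ K2G ⇒ for every `m ≥ 1` and every `M`, free finite-energy
classical flow at unit viscosity started below sup-level `1` is NOT bounded by `M` within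
`(3/2)·(25/9)·4bβ·log N_{m+1}·N_m^{β−2}` time units (`≈ 1.76·10³` at `m = 1`, `≈ 2.33·10³` at
`m = 2`) — the cruxes assert blow-up of the universal amplification function at `1.5` rigid windows
of EVERY level. [cite: Palasek2026ElementaryModel, §4] -/
theorem not_supGrowthBound_unit_of_episodesG (h₁ : EpisodeBaseG) (h₂ : EpisodeInductionG) {m : ℕ}
    (hm : 1 ≤ m) (M : ℝ) :
    ¬ SupGrowthBound 1 1
      (3 / 2 * (25 / 9 * (4 * TowerRates.wide.b * TowerRates.wide.β) *
        Real.log (TowerRates.wide.N (m + 1)) * TowerRates.wide.N m ^ (TowerRates.wide.β - 2))) M := by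
  have hYm : 0 < TowerRates.wide.Y m := Real.rpow_pos_of_pos (TowerRates.wide.N_pos m) _
  have hA : 0 < 5 / 3 * TowerRates.wide.Y m := by positivity
  intro hG
  refine not_supGrowthBound_of_episodesG h₁ h₂ hm M ((supGrowthBound_iff_unit one_pos hA).2 ?_)
  rw [div_one, show 3 / 2 * TowerRates.wide.window m * (5 / 3 * TowerRates.wide.Y m) ^ 2 =
    3 / 2 * (TowerRates.wide.window m * (5 / 3 * TowerRates.wide.Y m) ^ 2) by ring,
    window_mul_ceiling_sq_eq m]
  exact hG

end Summit.NavierStokesRegularity.FluidComputer.PalasekTowerClayBridge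

set_option linter.dupNamespace false

namespace Summit.NavierStokesRegularity.NavierStokesRegularity.Theorems

open Summit.NavierStokesRegularity.NavierStokesRegularity.Theses
open Summit.NavierStokesRegularity.FluidComputer.PalasekTowerClayBridge
open Literature.Analysis.FluidPDE

/-! ## §1 By name: the upper stub, the item, the sibling and the parent from the predicate + floors -/

/-- **The UPPER STUB of item 19249 from the universal amplification bound**: if free finite-energy
classical flow at unit viscosity started below `(5/3)·Y₁` cannot amplify its sup by the factor `Y₂/Y₁`
(`= N₁^{0.13} ≈ 2.21`) within the rigid window `4bβ·log N₂/A₁`, then `AprioriCeilingAt 1`.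
[cite: Palasek2026ElementaryModel, §4] -/
theorem palasekTowerBreakdown_aprioriCeilingAt_one_of_supGrowthBound
    (h : SupGrowthBound 1 (5 / 3 * TowerRates.wide.Y 1) (TowerRates.wide.window 1)
      (TowerRates.wide.Y 2 / TowerRates.wide.Y 1)) :
    AprioriCeilingAt 1 :=
  aprioriCeilingAt_one_of_supGrowthBound h

/-- **Item `PalasekTowerBreakdown.HeredityAtOne` from the amplification bound and the three level-2
floors** (the registered line's composition with its upper stub discharged by the register-free
hypothesis). [cite: Palasek2026ElementaryModel, §4] -/
theorem palasekTowerBreakdown_heredityAtOne_of_supGrowthBound_floors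
    (h : SupGrowthBound 1 (5 / 3 * TowerRates.wide.Y 1) (TowerRates.wide.window 1)
      (TowerRates.wide.Y 2 / TowerRates.wide.Y 1))
    (h₁ : SpeedFloorAt 1) (h₂ : StrainFloorAt 1) (h₃ : CoreFloorAt 1) :
    PalasekTowerBreakdown.HeredityAtOne := by
  unfold PalasekTowerBreakdown.HeredityAtOne
  exact heredityAtOne_of_apriori_floors (aprioriCeilingAt_one_of_supGrowthBound h) h₁ h₂ h₃

/-- **The same in Kato units** (factor `N₁^{(b−1)(β−1)}` within `(25/9)·4bβ·log N₂·N₁^{β−2}` from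
sup-level `1` at unit viscosity). [cite: Palasek2026ElementaryModel, §4] -/
theorem palasekTowerBreakdown_heredityAtOne_of_supGrowthBound_unit_floors
    (h : SupGrowthBound 1 1
      (25 / 9 * (4 * TowerRates.wide.b * TowerRates.wide.β) *
        Real.log (TowerRates.wide.N 2) * TowerRates.wide.N 1 ^ (TowerRates.wide.β - 2))
      (TowerRates.wide.N 1 ^ ((TowerRates.wide.b - 1) * (TowerRates.wide.β - 1))))
    (h₁ : SpeedFloorAt 1) (h₂ : StrainFloorAt 1) (h₃ : CoreFloorAt 1) :
    PalasekTowerBreakdown.HeredityAtOne := by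
  unfold PalasekTowerBreakdown.HeredityAtOne
  exact heredityAtOne_of_apriori_floors (aprioriCeilingAt_of_supGrowthBound_unit le_rfl h) h₁ h₂ h₃

/-- **The sibling `PalasekTowerBreakdown.HeredityFromTwo`** from one amplification bound per level
`k ≥ 2` and the three floors there. [cite: Palasek2026ElementaryModel, §4] -/
theorem palasekTowerBreakdown_heredityFromTwo_of_supGrowthBound_floors
    (h : ∀ k : ℕ, 2 ≤ k → SupGrowthBound 1 (5 / 3 * TowerRates.wide.Y k) (TowerRates.wide.window k)
      (TowerRates.wide.Y (k + 1) / TowerRates.wide.Y k))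
    (hF : ∀ k : ℕ, 2 ≤ k → SpeedFloorAt k ∧ StrainFloorAt k ∧ CoreFloorAt k) :
    PalasekTowerBreakdown.HeredityFromTwo := by
  unfold PalasekTowerBreakdown.HeredityFromTwo
  rw [heredityFrom_iff_forall_apriori_and_floors (by norm_num : 1 ≤ 2)]
  intro k hk
  obtain ⟨h₁, h₂, h₃⟩ := hF k hk
  exact ⟨aprioriCeilingAt_of_supGrowthBound_ratio (by omega) (h k hk), readoutFloorsAt_of_floors h₁ h₂ h₃⟩

/-- **The parent `PalasekTowerBreakdown.EpisodeInduction` (= K2G)** from one amplification bound per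
level `k ≥ 1` and the three floors there — modulo the floors, the crux of the route is one
register-free number per level. [cite: Palasek2026ElementaryModel, §4] -/
theorem palasekTowerBreakdown_episodeInduction_of_supGrowthBound_floors
    (h : ∀ k : ℕ, 1 ≤ k → SupGrowthBound 1 (5 / 3 * TowerRates.wide.Y k) (TowerRates.wide.window k)
      (TowerRates.wide.Y (k + 1) / TowerRates.wide.Y k))
    (hF : ∀ k : ℕ, 1 ≤ k → SpeedFloorAt k ∧ StrainFloorAt k ∧ CoreFloorAt k) :
    PalasekTowerBreakdown.EpisodeInduction := by
  unfold PalasekTowerBreakdown.EpisodeInduction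
  rw [episodeInductionG_iff_forall_apriori_and_floors]
  intro k hk
  obtain ⟨h₁, h₂, h₃⟩ := hF k hk
  exact ⟨aprioriCeilingAt_of_supGrowthBound_ratio hk (h k hk), readoutFloorsAt_of_floors h₁ h₂ h₃⟩

/-! ## §2 By name: the two cruxes refute every amplification bound on `1.5` windows -/

/-- **`EpisodeBase ∧ EpisodeInduction` ⇒ no amplification bound survives `1.5` rigid windows, at any
level `m ≥ 1`** (route items by name; UNCONDITIONAL implication):
`¬ SupGrowthBound 1 ((5/3)·Y_m) ((3/2)·window m) M` for every `M`. Side by side with §1: the upper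
stubs follow from `G(Θ_m) ≤ N_m^{0.13}`; the cruxes force `G(1.5·Θ_m) = ∞`.
[cite: Palasek2026ElementaryModel, §4] -/
theorem palasekTowerBreakdown_not_supGrowthBound_of_episodes (h₁ : PalasekTowerBreakdown.EpisodeBase)
    (h₂ : PalasekTowerBreakdown.EpisodeInduction) {m : ℕ} (hm : 1 ≤ m) (M : ℝ) :
    ¬ SupGrowthBound 1 (5 / 3 * TowerRates.wide.Y m) (3 / 2 * TowerRates.wide.window m) M :=
  not_supGrowthBound_of_episodesG h₁ h₂ hm M

/-- **The same in Kato units**: the route's two cruxes assert that free finite-energy classical flow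
from sup-level `1` at unit viscosity is unbounded within `(3/2)·(25/9)·4bβ·log N_{m+1}·N_m^{β−2}` time
units, for every `m ≥ 1`. [cite: Palasek2026ElementaryModel, §4] -/
theorem palasekTowerBreakdown_not_supGrowthBound_unit_of_episodes
    (h₁ : PalasekTowerBreakdown.EpisodeBase) (h₂ : PalasekTowerBreakdown.EpisodeInduction) {m : ℕ}
    (hm : 1 ≤ m) (M : ℝ) :
    ¬ SupGrowthBound 1 1
      (3 / 2 * (25 / 9 * (4 * TowerRates.wide.b * TowerRates.wide.β) *
        Real.log (TowerRates.wide.N (m + 1)) * TowerRates.wide.N m ^ (TowerRates.wide.β - 2))) M :=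
  not_supGrowthBound_unit_of_episodesG h₁ h₂ hm M

/-- **With the first rung in place of the whole induction** (items `EpisodeBase`, `HeredityAtOne`):
the rung `RungG 2` already refutes every amplification bound on `1.5` windows of level `1` up to the
factor `Y₂/((5/3)Y₁)` — precisely: `SupGrowthBound 1 ((5/3)·Y₁) ((3/2)·window 1) M` fails for every
`M` with `M·(5/3)·Y₁ < Y₂` (e.g. `M ≤ 1.32`). [cite: Palasek2026ElementaryModel, §4] -/
theorem palasekTowerBreakdown_not_supGrowthBound_of_base_heredityAtOne
    (h₁ : PalasekTowerBreakdown.EpisodeBase) (h₂ : PalasekTowerBreakdown.HeredityAtOne) {M : ℝ}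
    (hM : M * (5 / 3 * TowerRates.wide.Y 1) < TowerRates.wide.Y 2) :
    ¬ SupGrowthBound 1 (5 / 3 * TowerRates.wide.Y 1) (3 / 2 * TowerRates.wide.window 1) M := by
  intro hG
  obtain ⟨S, -, hR, hQ, ⟨s⟩⟩ : RungG 2 := rungG_two_of_heredityAtOne h₁ h₂
  have hτ1 : 0 < S.τ 1 := S.τ_pos 1
  have h12 : S.τ 1 < S.τ 2 := S.τ_lt_succ 1
  have hf : ∀ r, S.τ 1 ≤ r → S.f r = 0 := fun r hr => hQ r hr
  have hU : IsClassicalNSSolutionOn (Icc 0 (S.τ 2 - S.τ 1)) 1 0 (fun r => s.u (r + S.τ 1))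
      (fun r => s.p (r + S.τ 1)) :=
    isClassicalNSSolutionOn_translate_of_silent s.classical hτ1.le h12 hf
  have hEU : ∃ C : ℝ≥0∞, C < ⊤ ∧ ∀ r ∈ Icc 0 (S.τ 2 - S.τ 1),
      ∫⁻ y, ‖s.u (r + S.τ 1) y‖ₑ ^ 2 ≤ C := by
    obtain ⟨C, hC, hb⟩ := s.energy
    exact ⟨C, hC, fun r hr => hb (r + S.τ 1) ⟨by linarith [hr.1], by linarith [hr.2]⟩⟩
  have hU0 : ∀ y, ‖(fun r => s.u (r + S.τ 1)) 0 y‖ ≤ 5 / 3 * TowerRates.wide.Y 1 := by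
    intro y
    simp only [zero_add]
    rw [← hR.c₂_eq]
    exact s.ceiling 1 (by norm_num) (S.τ 1) ⟨hτ1.le, le_rfl⟩ y
  have hlen : S.τ 2 - S.τ 1 ≤ 3 / 2 * TowerRates.wide.window 1 :=
    hR.τ_sub_τ_le_window (by norm_num)
  obtain ⟨x₀, -, hfl⟩ := s.floor 2 le_rfl
  have key := hG (by linarith) hlen _ _ hU hEU hU0 (S.τ 2 - S.τ 1) ⟨by linarith, le_rfl⟩ x₀
  simp only [sub_add_cancel] at key
  rw [hR.c₁_eq, one_mul] at hfl
  linarith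

end Summit.NavierStokesRegularity.NavierStokesRegularity.Theorems


/-! ## §3 (append, same seat) The whole tower lives within `1.5` windows of ANY readout: blow-up time by name -/

namespace Summit.NavierStokesRegularity.FluidComputer.PalasekTowerClayBridge

open Literature.Analysis.FluidPDE

/-- **The blow-up time of a rigid wide schedule is within `(3/2)·window m` of every readout `τ_m`**:
`T − τ_m ≤ (3/2)·4bβ·log N_{m+1}/A_m` (the clock makes the readouts exhaust `[0, T)`,
`Schedule.exists_lt_τ`; every later readout is within `(3/2)·window m`, `τ_sub_τ_le_window`). At
`m = 0`: the design's entire life after first hitting is `≤ (3/2)·window 0 ≈ 2.7·10⁻⁴`, i.e. at most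
`(3/2)·4bβ·b·log N₀·N₀^{β−2} ≈ 489` sup-norm scaling times of the anchor speed `Y₀`. [folklore] -/
theorem Schedule.Rigid.T_sub_τ_le_window {S : Schedule TowerRates.wide} (hR : S.Rigid) (m : ℕ) :
    S.T - S.τ m ≤ 3 / 2 * TowerRates.wide.window m := by
  by_contra h
  have h' : 3 / 2 * TowerRates.wide.window m < S.T - S.τ m := lt_of_not_ge h
  obtain ⟨n, hn⟩ := S.exists_lt_τ (show S.τ m + 3 / 2 * TowerRates.wide.window m < S.T by linarith)
  rcases le_or_gt m (n + 1) with hmn | hmn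
  · have := hR.τ_sub_τ_le_window hmn
    linarith
  · have h1 : S.τ (n + 1) < S.τ m := S.τ_strictMono hmn
    have h2 : 0 < TowerRates.wide.window m := TowerRates.wide.window_pos m
    linarith

/-- The same in Kato units of the level-`m` CEILING speed: `(T − τ_m)·((5/3)Y_m)² ≤ (3/2)·Θ_m`,
`Θ_m = (25/9)·4bβ·log N_{m+1}·N_m^{β−2}` (`≈ 1.36·10³, 1.76·10³, 2.33·10³` at `m = 0, 1, 2`). [folklore] -/
theorem Schedule.Rigid.T_sub_τ_mul_ceiling_sq_le {S : Schedule TowerRates.wide} (hR : S.Rigid) (m : ℕ) :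
    (S.T - S.τ m) * (5 / 3 * TowerRates.wide.Y m) ^ 2 ≤
      3 / 2 * (25 / 9 * (4 * TowerRates.wide.b * TowerRates.wide.β) *
        Real.log (TowerRates.wide.N (m + 1)) * TowerRates.wide.N m ^ (TowerRates.wide.β - 2)) := by
  rw [← window_mul_ceiling_sq_eq m, ← mul_assoc]
  exact mul_le_mul_of_nonneg_right (hR.T_sub_τ_le_window m) (sq_nonneg _)

end Summit.NavierStokesRegularity.FluidComputer.PalasekTowerClayBridge

namespace Summit.NavierStokesRegularity.NavierStokesRegularity.Theorems

open Summit.NavierStokesRegularity.NavierStokesRegularity.Theses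
open Summit.NavierStokesRegularity.FluidComputer.PalasekTowerClayBridge
open Literature.Analysis.FluidPDE

/-- **By name: the route's tower, if it exists, blows up within `1.5` windows of its first readout.**
`EpisodeBase → EpisodeInduction →` there is a realisation of the wide tower at unit viscosity
(`Realisation.ofEpisodes`) whose blow-up time satisfies `T − τ₀ ≤ (3/2)·window 0` and, at every
level, `T − τ_m ≤ (3/2)·window m` — the registered blow-up is FAST in Kato units of every ceiling it
passes (`≤ 1.5·Θ_m`), which is the quantitative content behind §2. [cite: Palasek2026ElementaryModel, §4] -/
theorem palasekTowerBreakdown_realisation_blowup_within_windows (h₁ : PalasekTowerBreakdown.EpisodeBase)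
    (h₂ : PalasekTowerBreakdown.EpisodeInduction) :
    ∃ W : Realisation 1 TowerRates.wide, ∀ m : ℕ, W.T - W.τ m ≤ 3 / 2 * TowerRates.wide.window m := by
  have h₁' : EpisodeBaseG := h₁
  have h₂' : EpisodeInductionG := h₂
  obtain ⟨S, hP, hR, hQ, ⟨s₁⟩⟩ := h₁'
  exact ⟨Realisation.ofEpisodes S s₁ (fun n s => h₂' S hP hR hQ (n + 1) (by omega) s),
    fun m => hR.T_sub_τ_le_window m⟩

end Summit.NavierStokesRegularity.NavierStokesRegularity.Theorems

end
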